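import Summits.ResolutionOfSingularities.ResolutionOfSingularities.Theorems.FrobeniusClosingSteerWords17ALandedLeaves
import Summits.ResolutionOfSingularities.ResolutionOfSingularities.Theorems.FrobeniusClosingSteerCompositeRankLUBelow
import Summits.ResolutionOfSingularities.ResolutionOfSingularities.Theorems.FrobeniusClosingSteerShannonCoarseningDiscrete
import Summits.ResolutionOfSingularities.ResolutionOfSingularities.Theorems.FrobeniusClosingSteerWords05HeartCycles
import Summits.ResolutionOfSingularities.ResolutionOfSingularities.Theorems.FrobeniusClosingSteerLUZeroDimOfTorsor

/-!
# Crux `Steer` (stmt-ResolutionOfSingularities-16345), line `switching-dichotomy` — WORDS 25B: the TAIL, part 2 — MODEL EXITS (`NoLogFinalModel`, `NoExitModel`), the M-vocabulary of the registered frontier stubs S3ᴹ / NSCᴹ (`EternalStallPhaseSSM`, `EternalAlternationSSM`, `NonSwitchingCoreM` = TYPE of the registered `stub_nonSwitchingCoreM`, `EternalCyclesSSM` = TYPE of the registered `stub_eternalCyclesSSM`, the `…_of_SSL` / `…_of_seqLogFinalSS` / `…_of_cycles` / `…_of_cyclesM` glue, `concl_of_cyclesM`) and the S0 reductions (`LUZeroDimBelow`,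 `h1dDiscrete`, `compositeRankSS_of_luZeroDimBelow`, `compositeRankSS_of_temkin2013Relative`) — PURE declarations only (HOIST of the registered skeleton r48 380a05c149e3c83c, l.5303–5710 minus the stub consumers)

Holder res-L0-w41-lead-1 g6 on res-L0-w41-plan-1 RULING 47 (E1) / 104b; see `…Words01Core` for the hoist protocol (bodies byte for byte;
`[cite: …]` / `[folklore]` tags on CLOSED `def … : Prop` words are written «(ref. …)» / «(folklore)» — GATE NOTE of `…Words02Stubs`;
cite keys inside `[cite:]` tags normalised to `references.bib` keys where needed, as in `…Words03Phases`).
Nothing here is a statement of the manuscript [claim: Hironaka2017, status: under-review]. OURS (candidates / vocabulary; AI review is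
weaker than expert review).
-/

open Summit.ResolutionOfSingularities.ResolutionOfSingularities.Theses.FrobeniusClosing (IsolatedForcedTermination)
open Literature.AlgebraicGeometry.Resolution (IsAbhyankarPlace FGOver exists_ringKrullDim_eq_and_trdeg_eq
  trdeg_eq_trdeg_of_isFractionRing locAtCentre IsQuadraticTransformAlong SubringDominates IsRsopPart
  LocalUniformization3 RelLocalUniformization CossartPiltant2019General)
open Summit.ResolutionOfSingularities.ResolutionOfSingularities.Theorems.SteerRankThinness
  (HasProperCoarsening concl_of_hasProperCoarsening rankOne_of_not_hasProperCoarsening)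
open Summit.ResolutionOfSingularities.ResolutionOfSingularities.Theorems.PfaffLine

set_option linter.dupNamespace false

namespace Summit.ResolutionOfSingularities.ResolutionOfSingularities.Theorems.SwitchingDichotomy.Words

/-! ### r23-CANDIDATE (res-D-pv-028, STAGED Φ3ᴸˢ/Φ4ᴸˢ hand; scratch — NOT the skeleton of record): MODEL-FORM EXITS SPLIT OFF
BEFORE THE FRONTIER. The three frontier residuals Φ3ᴸˢ / Φ4ᴸˢ / NSC receive two EXTRA binders — «no finitely generated model
`A₀ ≤ A₁ ⊆ O` of `Frac A₀`, regular at the centre of `O`, is LOG-FINAL» (`NoLogFinalModel`, verbatim the antecedents of the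
registered `LogFinalExitM`) and «no finitely generated `A₀ ≤ A₁ ⊆ O` regular at the centre of `O` carries an EXIT stage»
(`NoExitModel`) — because BOTH splits are dischargeable: `stub_logFinalExitM` (registered, already in model form) and P1ᴹ
`GenExitModel.genExitModel` (res-D-pv-028, Theses-free helper). Rationale: exits and log-final presentations are NOT
upward-stable under domination (res-L0-w41-tri-1 TRIAGE v4 lens P-b), so the member-form hypotheses `∀ M, ¬ LogExitAt (R M) …` /
`∀ M, ¬ ExitAt (R M) …` leave data inside the residuals that exit on a NON-member model; the model-form binders remove exactly
that class. The old residuals imply the new ones (`…M_of_…`, drop the binders), so the reshape is a pure WEAKENING of the three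
registered frontier statements; `Sig.stub_core4LowMultOdd` stays DERIVED (`core4LowMultOdd_of_models`). -/

section ModelExits

variable {k K : Type} [Field k] [Field K] [Algebra k K]

/-- **No finitely generated model of `Frac A₀` over `A₀` inside `O`, regular at the centre, is log-final for `t`** — verbatim
the antecedents of `LogFinalExitM p` after the datum binders, negated. OURS. [cite: Posva2023, Lemma 9] [folklore] -/
def NoLogFinalModel (p : ℕ) (O : ValuationSubring K) (A₀ : Subalgebra k K) (t : K) : Prop :=
  ∀ (A₁ : Subalgebra k K), A₀ ≤ A₁ → A₁.FG → (∀ x ∈ A₁, IsFracOf A₀ x) → A₁.toSubring ≤ O.toSubring →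
    ∀ (_ : IsLocalRing (locAtCentre A₁.toSubring O)),
      IsRegularLocalRing (locAtCentre A₁.toSubring O) → ¬ LogFinalAt p (locAtCentre A₁.toSubring O) A₀ t

/-- **No finitely generated `A₀ ≤ A₁ ⊆ O`, regular at the centre of `O`, carries an exit stage for `t`** (some generator of
the torsor over `(A₁)_{𝔪_O ∩ A₁}` in order-one form). OURS. [cite: HeinzerEtAl2015, Prop. 4.4] [folklore] -/
def NoExitModel (p : ℕ) (O : ValuationSubring K) (A₀ : Subalgebra k K) (t : K) : Prop :=
  ∀ (A₁ : Subalgebra k K) (h₁ : A₁.toSubring ≤ O.toSubring), A₀ ≤ A₁ → A₁.FG →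
    IsRegularLocalRing (Localization.AtPrime
      (Ideal.comap (Subring.inclusion h₁) (IsLocalRing.maximalIdeal O))) →
    ¬ ExitAt (locAtCentre A₁.toSubring O) p t

end ModelExits

/-- **Φ3ᴹ · EternalStallPhaseSSM** = Φ3ᴸˢ with the two model-form binders `NoLogFinalModel` / `NoExitModel` (FRONTIER; proposed
replacement of the registered `stub_eternalStallPhaseSSL`). OURS. (ref. CossartPiltant2019, Rem. 3.2) (ref. CutkoskyMourtada2019,
Thm. 7.1) (ref. HeinzerEtAl2015, Discussion 4.2) -/
def EternalStallPhaseSSM : Prop :=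
  ∀ p : ℕ, p.Prime → p ≠ 2 → ∀ n : ℕ, 4 ≤ n → TorsorLUZeroDimBelow p n →
    ∀ (k K : Type) [Field k] [CharP k p] [PerfectField k] [Field K] [Algebra k K]
    (O : ValuationSubring K) (A₀ : Subalgebra k K) (h₀ : A₀.toSubring ≤ O.toSubring) (t : K),
    CoreDatum p n k K O A₀ h₀ t → StronglySwitching O A₀ → (n = 4 → ¬ HasProperCoarsening O) →
    NoLogFinalModel p O A₀ t → NoExitModel p O A₀ t →
    ∀ R : ℕ → Subring K, R 0 = locAtCentre A₀.toSubring O →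
      (∀ i, IsQuadraticTransformAlong O (R i) (R (i + 1))) →
      (∀ M, ¬ LogExitAt (R M) p A₀ t) →
      (¬ HasProperCoarsening O → ∀ x : ℕ → K, (∀ i, IsExcParam O (R i) (x i)) →
        ∀ c : K, c ≠ 0 → ∃ m, (∏ i ∈ Finset.range m, O.valuation (x i)) < O.valuation c) →
      (∃ M₀ : ℕ, ∀ M, M₀ ≤ M → StallAt O (R M) p t) → Concl O A₀ t

/-- **Φ4ᴹ · EternalAlternationSSM** = Φ4ᴸˢ with the two model-form binders (FRONTIER; proposed replacement of the registered
`stub_eternalAlternationSSL`). OURS. (ref. HeinzerEtAl2015, Discussion 4.2) (ref. Kuhlmann2010Defect, §2)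
(ref. CutkoskyMourtada2019, Thm. 7.1) -/
def EternalAlternationSSM : Prop :=
  ∀ p : ℕ, p.Prime → p ≠ 2 → ∀ n : ℕ, 4 ≤ n → TorsorLUZeroDimBelow p n →
    ∀ (k K : Type) [Field k] [CharP k p] [PerfectField k] [Field K] [Algebra k K]
    (O : ValuationSubring K) (A₀ : Subalgebra k K) (h₀ : A₀.toSubring ≤ O.toSubring) (t : K),
    CoreDatum p n k K O A₀ h₀ t → StronglySwitching O A₀ → (n = 4 → ¬ HasProperCoarsening O) →
    NoLogFinalModel p O A₀ t → NoExitModel p O A₀ t →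
    ∀ R : ℕ → Subring K, R 0 = locAtCentre A₀.toSubring O →
      (∀ i, IsQuadraticTransformAlong O (R i) (R (i + 1))) →
      (∀ M, ¬ LogExitAt (R M) p A₀ t) →
      (¬ HasProperCoarsening O → ∀ x : ℕ → K, (∀ i, IsExcParam O (R i) (x i)) →
        ∀ c : K, c ≠ 0 → ∃ m, (∏ i ∈ Finset.range m, O.valuation (x i)) < O.valuation c) →
      (∀ M, ¬ ExitAt (R M) p t) →
      (∀ M₀ : ℕ, ∃ M, M₀ ≤ M ∧ MultPAt O (R M) p t) →
      (∀ (M : ℕ) (s' : K) (R' : ℕ → Subring K) (u : ℕ → K), GenAt (R M) p t s' →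
        R' 0 = R M → (∀ i, IsQuadraticTransformAlong O (R' i) (R' (i + 1))) →
        ¬ IsTorsorRun O R' s' p u) →
      Concl O A₀ t

/-- **NSCᴹ · NonSwitchingCoreM** = `NonSwitchingCore` with the two model-form binders (FRONTIER as a whole; proposed replacement of
the registered `stub_nonSwitchingCore`). OURS. (ref. HeinzerEtAl2015, Discussion 4.2) (ref. CossartPiltant2019, Thm. 1.1) -/
def NonSwitchingCoreM : Prop :=
  ∀ p : ℕ, p.Prime → p ≠ 2 → ∀ n : ℕ, 4 ≤ n → TorsorLUZeroDimBelow p n →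
    ∀ (k K : Type) [Field k] [CharP k p] [PerfectField k] [Field K] [Algebra k K]
    (O : ValuationSubring K) (A₀ : Subalgebra k K) (h₀ : A₀.toSubring ≤ O.toSubring) (t : K),
    CoreDatum p n k K O A₀ h₀ t → (n = 4 → ¬ HasProperCoarsening O) →
    NoLogFinalModel p O A₀ t → NoExitModel p O A₀ t → ¬ StronglySwitching O A₀ → Concl O A₀ t

/-- The registered Φ3ᴸˢ implies Φ3ᴹ (drop the two binders): the reshape WEAKENS the registered statement. Pure logic. -/
theorem eternalStallPhaseSSM_of_SSL (h : EternalStallPhaseSSL) : EternalStallPhaseSSM :=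
  fun p hp hp2 n hn hB k K _ _ _ _ _ O A₀ h₀ t core hss hnc _ _ R hR0 hRq hnl _ hq =>
    h p hp hp2 n hn hB k K O A₀ h₀ t core hss hnc R hR0 hRq hnl hq

/-- The registered Φ4ᴸˢ implies Φ4ᴹ. Pure logic. -/
theorem eternalAlternationSSM_of_SSL (h : EternalAlternationSSL) : EternalAlternationSSM :=
  fun p hp hp2 n hn hB k K _ _ _ _ _ O A₀ h₀ t core hss hnc _ _ R hR0 hRq hnl _ hne hmp hdie =>
    h p hp hp2 n hn hB k K O A₀ h₀ t core hss hnc R hR0 hRq hnl hne hmp hdie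

/-- The registered `NonSwitchingCore` implies NSCᴹ. Pure logic. -/
theorem nonSwitchingCoreM_of_nonSwitchingCore (h : NonSwitchingCore) : NonSwitchingCoreM :=
  fun p hp hp2 n hn hB k K _ _ _ _ _ O A₀ h₀ t core hnc _ _ hss => h p hp hp2 n hn hB k K O A₀ h₀ t core hnc hss

/-- idea-2's sequence form still makes Φ3ᴹ hold vacuously. Pure logic. -/
theorem eternalStallPhaseSSM_of_seqLogFinalSS (h : SeqLogFinalSS) : EternalStallPhaseSSM :=
  eternalStallPhaseSSM_of_SSL (eternalStallPhaseSSL_of_seqLogFinalSS h)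

/-- idea-2's sequence form still makes Φ4ᴹ hold vacuously. Pure logic. -/
theorem eternalAlternationSSM_of_seqLogFinalSS (h : SeqLogFinalSS) : EternalAlternationSSM :=
  eternalAlternationSSM_of_SSL (eternalAlternationSSL_of_seqLogFinalSS h)

/-- strat-1's §F decomposition feeds the M-form Φ3 as well (M-forms are weaker). Pure logic. -/
theorem eternalStallPhaseSSM_of_cycles (h0 : CompositeRankSS) (h1 : SSMonomialization) (h2 : MonomialStageTrichotomy)
    (h3 : EternalCyclesSS) : EternalStallPhaseSSM :=
  eternalStallPhaseSSM_of_SSL (eternalStallPhaseSSL_of_cycles h0 h1 h2 h3)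

/-- strat-1's §F decomposition feeds the M-form Φ4 as well. Pure logic. -/
theorem eternalAlternationSSM_of_cycles (h0 : CompositeRankSS) (h1 : SSMonomialization) (h2 : MonomialStageTrichotomy)
    (h3 : EternalCyclesSS) : EternalAlternationSSM :=
  eternalAlternationSSM_of_SSL (eternalAlternationSSL_of_cycles h0 h1 h2 h3)


/-! #### S3ᴹ — the same two binders threaded into res-L0-w41-strat-1's §F residual `EternalCyclesSS` (so that the alternative
decomposition Φ3+Φ4 → {S0, S3} stays M-sharp: `…SSM_of_cyclesM`). -/

/-- **S3ᴹ · EternalCyclesSSM** = strat-1's `EternalCyclesSS` with the two model-form binders. OURS. (folklore) -/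
def EternalCyclesSSM : Prop :=
  ∀ p : ℕ, p.Prime → p ≠ 2 → ∀ n : ℕ, 4 ≤ n → TorsorLUZeroDimBelow p n →
    ∀ (k K : Type) [Field k] [CharP k p] [PerfectField k] [Field K] [Algebra k K]
    (O : ValuationSubring K) (A₀ : Subalgebra k K) (h₀ : A₀.toSubring ≤ O.toSubring) (t : K),
    CoreDatum p n k K O A₀ h₀ t → StronglySwitching O A₀ → ¬ HasProperCoarsening O →
    NoLogFinalModel p O A₀ t → NoExitModel p O A₀ t →
    ∀ R : ℕ → Subring K, R 0 = locAtCentre A₀.toSubring O →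
      (∀ i, IsQuadraticTransformAlong O (R i) (R (i + 1))) →
      (∀ M, ¬ LogExitAt (R M) p A₀ t) → (∀ M, ¬ ExitAt (R M) p t) →
      (¬ HasProperCoarsening O → ∀ x : ℕ → K, (∀ i, IsExcParam O (R i) (x i)) →
        ∀ c : K, c ≠ 0 → ∃ m, (∏ i ∈ Finset.range m, O.valuation (x i)) < O.valuation c) →
      ∀ (Mj : ℕ → ℕ) (s μ c : ℕ → K), Monotone Mj →
        (∀ j, GenAt (R (Mj j)) p t (s j) ∧ s j ≠ 0 ∧ O.valuation (s j ^ p) < 1) →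
        (∀ j, μ j ∈ R (Mj (j + 1)) ∧ c j ∈ R (Mj (j + 1)) ∧
          (∃ (_ : IsLocalRing (R (Mj (j + 1)))), MonomialAt (R (Mj (j + 1))) (μ j)) ∧
          O.valuation (c j) = 1 ∧ O.valuation (μ j) < 1 ∧ s j = μ j * (s (j + 1) + c j)) →
        Concl O A₀ t

/-- strat-1's S3 implies S3ᴹ (drop the binders). Pure logic. -/
theorem eternalCyclesSSM_of_SS (h : EternalCyclesSS) : EternalCyclesSSM :=
  fun p hp hp2 n hn hB k K _ _ _ _ _ O A₀ h₀ t core hss hr1 _ _ R hR0 hRq hnl hne _ Mj s μ c hMj hgen hcyc =>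
    h p hp hp2 n hn hB k K O A₀ h₀ t core hss hr1 R hR0 hRq hnl hne Mj s μ c hMj hgen hcyc

/-- **The cycle engine with the model-form binders threaded to S3ᴹ** (= `concl_of_cycles` verbatim). OURS. [folklore] -/
theorem concl_of_cyclesM (h1 : SSMonomialization) (h2 : MonomialStageTrichotomy) (h3 : EternalCyclesSSM)
    {p : ℕ} (hp : p.Prime) (hp2 : p ≠ 2) {n : ℕ} (hn : 4 ≤ n) (hB : TorsorLUZeroDimBelow p n)
    (k K : Type) [Field k] [CharP k p] [PerfectField k] [Field K] [Algebra k K]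
    (O : ValuationSubring K) (A₀ : Subalgebra k K) (h₀ : A₀.toSubring ≤ O.toSubring) (t : K)
    (core : CoreDatum p n k K O A₀ h₀ t) (hss : StronglySwitching O A₀) (hr1 : ¬ HasProperCoarsening O)
    (hnlM : NoLogFinalModel p O A₀ t) (hneM : NoExitModel p O A₀ t)
    (R : ℕ → Subring K) (hR0 : R 0 = locAtCentre A₀.toSubring O)
    (hRq : ∀ i, IsQuadraticTransformAlong O (R i) (R (i + 1)))
    (hnl : ∀ M, ¬ LogExitAt (R M) p A₀ t) (hne : ∀ M, ¬ ExitAt (R M) p t)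
    (hdiv : ¬ HasProperCoarsening O → ∀ x : ℕ → K, (∀ i, IsExcParam O (R i) (x i)) →
      ∀ c : K, c ≠ 0 → ∃ m, (∏ i ∈ Finset.range m, O.valuation (x i)) < O.valuation c) : Concl O A₀ t := by
  classical
  have hmono : Monotone R := member_monotone O R hRq
  have step : ∀ (M : ℕ) (s : K), GenAt (R M) p t s → s ≠ 0 →
      ∃ (M' : ℕ) (s₁ μ c : K), M ≤ M' ∧ CycleStepAt O (R M') p t s s₁ μ c := by
    intro M s hg hs0
    obtain ⟨M', hMM', hloc, hmon⟩ :=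
      h1 p hp hp2 n hn k K O A₀ h₀ t core hss hr1 R hR0 hRq M (s ^ p) hg.1 (pow_ne_zero _ hs0)
    rcases h2 p hp hp2 n hn k K O A₀ h₀ t core hss hr1 R hR0 hRq M' s (genAt_mono (hmono hMM') hg)
        ⟨hloc, hmon⟩ with hl | hx | ⟨s₁, μ, c, hc⟩
    · exact absurd hl (hnl M')
    · exact absurd hx (hne M')
    · exact ⟨M', s₁, μ, c, hMM', hc⟩
  let St := {x : ℕ × K // GenAt (R x.1) p t x.2 ∧ x.2 ≠ 0}
  have hex : ∀ x : St, ∃ (y : St) (μ c : K), x.1.1 ≤ y.1.1 ∧ CycleStepAt O (R y.1.1) p t x.1.2 y.1.2 μ c := by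
    rintro ⟨⟨M, s⟩, hg, hs0⟩
    obtain ⟨M', s₁, μ, c, hle, hc⟩ := step M s hg hs0
    exact ⟨⟨(M', s₁), hc.2.2.2.2.2.2.1, hc.2.2.2.2.2.1⟩, μ, c, hle, hc⟩
  choose nxt μf cf hle hcyc using hex
  have t0 : GenAt (R 0) p t t ∧ t ≠ 0 := by
    obtain ⟨htp, -⟩ := core.2
    exact ⟨genAt_self O A₀ htp R hR0, t_ne_zero_of_coreDatum hp core⟩
  let run : ℕ → St := fun j => Nat.rec (⟨(0, t), t0⟩ : St) (fun _ x => nxt x) j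
  have hrun : ∀ j, run (j + 1) = nxt (run j) := fun j => rfl
  refine h3 p hp hp2 n hn hB k K O A₀ h₀ t core hss hr1 hnlM hneM R hR0 hRq hnl hne hdiv
    (fun j => (run (j + 1)).1.1) (fun j => (run (j + 1)).1.2) (fun j => μf (run (j + 1)))
    (fun j => cf (run (j + 1))) ?_ ?_ ?_
  · refine monotone_nat_of_le_succ fun j => ?_
    show (run (j + 1)).1.1 ≤ (run (j + 1 + 1)).1.1
    rw [hrun (j + 1)]
    exact hle (run (j + 1))
  · intro j
    refine ⟨(run (j + 1)).2.1, (run (j + 1)).2.2, ?_⟩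
    have h := hcyc (run j)
    rw [← hrun j] at h
    exact h.2.2.2.2.2.2.2.1
  · intro j
    have h := hcyc (run (j + 1))
    have h' := hcyc (run j)
    rw [← hrun (j + 1)] at h
    rw [← hrun j] at h'
    refine ⟨h.1, h.2.1, h.2.2.1, h.2.2.2.1, ?_, h.2.2.2.2.1⟩
    exact h.2.2.2.2.2.2.2.2 h'.2.2.2.2.2.2.2.1

/-- **Φ3ᴹ from S0 + S1 + S2 + S3ᴹ** (kernel-checked; concludes `EternalStallPhaseSSM` BY NAME). OURS. [folklore] -/
theorem eternalStallPhaseSSM_of_cyclesM (h0 : CompositeRankSS) (h1 : SSMonomialization)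
    (h2 : MonomialStageTrichotomy) (h3 : EternalCyclesSSM) : EternalStallPhaseSSM := by
  intro p hp hp2 n hn hB k K _ _ _ _ _ O A₀ h₀ t core hss hnc hnlM hneM R hR0 hRq hnl hdiv _
  by_cases hr : HasProperCoarsening O
  · exact h0 p hp hp2 n hn hB k K O A₀ h₀ t core hss (fun h4 => hnc h4 hr) hr
  · by_cases hx : ∃ M, ExitAt (R M) p t
    · obtain ⟨M, hM⟩ := hx
      exact genExit_holds p hp n hn k K O A₀ h₀ t core R hR0 hRq M hM
    · push Not at hx
      exact concl_of_cyclesM h1 h2 h3 hp hp2 hn hB k K O A₀ h₀ t core hss hr hnlM hneM R hR0 hRq hnl hx hdiv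

/-- **Φ4ᴹ from S0 + S1 + S2 + S3ᴹ** (kernel-checked; concludes `EternalAlternationSSM` BY NAME). OURS. [folklore] -/
theorem eternalAlternationSSM_of_cyclesM (h0 : CompositeRankSS) (h1 : SSMonomialization)
    (h2 : MonomialStageTrichotomy) (h3 : EternalCyclesSSM) : EternalAlternationSSM := by
  intro p hp hp2 n hn hB k K _ _ _ _ _ O A₀ h₀ t core hss hnc hnlM hneM R hR0 hRq hnl hdiv hne _ _
  by_cases hr : HasProperCoarsening O
  · exact h0 p hp hp2 n hn hB k K O A₀ h₀ t core hss (fun h4 => hnc h4 hr) hr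
  · exact concl_of_cyclesM h1 h2 h3 hp hp2 hn hB k K O A₀ h₀ t core hss hr hnlM hneM R hR0 hRq hnl hne hdiv

/-! #### S0 — THE REDUCTION OF RECORD beneath the registered name (res-L0-w41-plan-1 RULING 13a 07:59:48Z; res-type-028's slot
`SlotTest_r24_S0c.lean` text VERBATIM): `stub_compositeRankSS` = ⟨`LUZeroDimBelow p n`, `n ≥ 5`⟩ by `compositeRankSS_of_luZeroDimBelow`
(028: (H1) p507271/p508959, (H2) p509580 `SteerRankThinness.concl_of_exists_discreteCoarsening_of_luZeroDimBelow`, H1D-DISCRETE p511543 +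
`Shannon.discrete_of_stronglySwitching`); `n = 4` closes by `CossartPiltant2019LU3`. `LUZeroDimBelow p n` — zero-dimensional local
uniformization in transcendence degree `< n` over perfect fields — is the INDUCTIVE KNOT of the R1 side (summit-strength below `n`): it is
NOT registered and NOT a binder (plan-1 06:50:33Z / 13a). -/

section S0Reduction

open Summit.ResolutionOfSingularities.ResolutionOfSingularities.Theorems.SteerRankThinness
  (concl_of_exists_discreteCoarsening_of_luZeroDimBelow)
open Summit.ResolutionOfSingularities.ResolutionOfSingularities.Theorems.SwitchingDichotomy.Shannon
  (discrete_of_stronglySwitching)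

/-- ⟨LUZeroDimBelow p n⟩ (res-L0-w41-tri-1 fix (b); res-type-028 binder text 07:05:35Z, plan-1 RULING 5/13a): general zero-dimensional
local uniformization of finitely generated models of function fields of transcendence degree `< n` over perfect fields of characteristic
`p` — the inductive knot of the R1 side, NOT a registered stub. OURS. [cite: HeinzerEtAl2015, Lemma 8.6, Prop. 8.7] -/
def LUZeroDimBelow (p n : ℕ) : Prop :=
  ∀ (k : Type) [Field k] [CharP k p] [PerfectField k] (κ : Type) [Field κ] [Algebra k κ] (O' : ValuationSubring κ),
    (∀ c : k, algebraMap k κ c ∈ O') →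
    (∀ x : κ, x ∈ O' → ∃ f : Polynomial k, f ≠ 0 ∧ Polynomial.aeval x f ∈ O'.nonunits) →
    Algebra.trdeg k κ < (n : Cardinal) →
    ∀ (B : Subalgebra k κ) (hB : B.toSubring ≤ O'.toSubring), B.FG → IsFractionRing B κ →
      ∃ (B' : Subalgebra k κ) (hB' : B'.toSubring ≤ O'.toSubring), B ≤ B' ∧ B'.FG ∧
        IsRegularLocalRing (Localization.AtPrime
          ((IsLocalRing.maximalIdeal O').comap (Subring.inclusion hB')))

/-- **H1D-DISCRETE** (res-type-028, PROVED in the tree: `Shannon.discrete_of_stronglySwitching`): along a strongly switching core datum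
EVERY proper coarsening is discrete of rank one. [cite: HeinzerEtAl2015, Lemma 3.2, Prop. 3.3] -/
theorem h1dDiscrete {p : ℕ} (hp : p.Prime) {n : ℕ} {k K : Type} [Field k] [CharP k p] [PerfectField k] [Field K]
    [Algebra k K] (O : ValuationSubring K) (A₀ : Subalgebra k K) (h₀ : A₀.toSubring ≤ O.toSubring) (t : K)
    (core : CoreDatum p n k K O A₀ h₀ t) (hss : StronglySwitching O A₀) (hco : HasProperCoarsening O) :
    ∃ O₁ : ValuationSubring K, O ≤ O₁ ∧ O ≠ O₁ ∧ O₁ ≠ ⊤ ∧ Discrete O₁ := by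
  obtain ⟨-, htp, hfr, hreg, -⟩ := core
  obtain ⟨O₁, hO, hne, hO₁⟩ := hco
  exact ⟨O₁, hO, hne, hO₁, discrete_of_stronglySwitching p hp O O₁ hO hne hO₁ A₀ h₀ t htp hfr hreg hss⟩

/-- **S0 ⇐ ⟨LUZeroDimBelow p n, n ≥ 5⟩** (res-type-028's slot, one `exact`): the registered `CompositeRankSS` from the inductive knot
alone. OURS. [folklore] -/
theorem compositeRankSS_of_luZeroDimBelow
    (hLU : ∀ p n : ℕ, p.Prime → 5 ≤ n → LUZeroDimBelow p n) : CompositeRankSS := by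
  intro p hp _ n hn _ k K _ _ _ _ _ O A₀ h₀ t core hss hn4 hco
  have core' := core
  obtain ⟨hfg, htp, hfr, hreg, -, hZ, -, -, -, -, -, -, htr, -⟩ := core'
  exact concl_of_exists_discreteCoarsening_of_luZeroDimBelow p hp htr O (h1dDiscrete hp O A₀ h₀ t core hss hco) hZ
    A₀ h₀ t hfg htp hfr hreg (hLU p n hp (by omega) k)

end S0Reduction

/-! #### S0 CLOSES MODULO ⟨Temkin2013Relative⟩ (res-L0-w41-plan-1 RULING 14b/22a (i); res-type-028's `SlotTest_r24_S0d.lean` §-block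
VERBATIM over the LANDED T1 p513503 `…SteerZeroDimTowerClimb` + T2 p514282 `…SteerLUZeroDimOfTorsor`): the knot ⟨LUZeroDimBelow p n⟩ is
fed by the stub's OWN binder `TorsorLUZeroDimBelow p n` through Temkin's pushed chart, so the REGISTERED `CompositeRankSS` follows from the
NAMED FACT `Literature.AlgebraicGeometry.Resolution.Temkin2013Relative` alone (route item 16162's existing debt; conditional-result). -/
section S0Temkin

open Summit.ResolutionOfSingularities.ResolutionOfSingularities.Theorems.SteerRankThinness
  (concl_of_exists_discreteCoarsening_of_luZeroDimBelow)
open Summit.ResolutionOfSingularities.ResolutionOfSingularities.Theorems.ZeroDimTower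
  (luZeroDimBelow_of_torsorLUZeroDimBelow)

/-- **S0 ⇐ ⟨Temkin2013Relative⟩** (res-type-028's slot, one `exact`): the registered `CompositeRankSS` from Temkin's relative
inseparable local uniformization alone. OURS. [cite: Temkin2013, Thm. 1.3.2] -/
theorem compositeRankSS_of_temkin2013Relative
    (hTem : Literature.AlgebraicGeometry.Resolution.Temkin2013Relative.{0}) : CompositeRankSS := by
  intro p hp _ n hn hB k K _ _ _ _ _ O A₀ h₀ t core hss hn4 hco
  have core' := core
  obtain ⟨hfg, htp, hfr, hreg, -, hZ, -, -, -, -, -, -, htr, -⟩ := core'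
  exact concl_of_exists_discreteCoarsening_of_luZeroDimBelow p hp htr O (h1dDiscrete hp O A₀ h₀ t core hss hco) hZ
    A₀ h₀ t hfg htp hfr hreg (luZeroDimBelow_of_torsorLUZeroDimBelow hTem p n hp hB k)

end S0Temkin

end Summit.ResolutionOfSingularities.ResolutionOfSingularities.Theorems.SwitchingDichotomy.Words
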